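import Summits.ResolutionOfSingularities.ResolutionOfSingularities.Theses.Valuative
import Summits.ResolutionOfSingularities.ResolutionOfSingularities.Theorems.SandwichedSingularitiesResolution
import Summits.ResolutionOfSingularities.ResolutionOfSingularities.Theorems.SandwichedSingularitiesResolutionSlices
import Summits.ResolutionOfSingularities.ResolutionOfSingularities.Theorems.ValuativePatchingRelLocalRegLeificationWeak
import Summits.ResolutionOfSingularities.ResolutionOfSingularities.Theorems.ValuativePatchingRelRegLeificationOfSandwichedLocus
import Summits.ResolutionOfSingularities.ResolutionOfSingularities.Theorems.ValuativePatchingRelSandwichedBridges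
import Summits.ResolutionOfSingularities.ResolutionOfSingularities.Theorems.ValuativePatchingRelBlowupExtension
import Summits.ResolutionOfSingularities.ResolutionOfSingularities.Theorems.ValuativePatchingRelBlowupBridge
import Summits.ResolutionOfSingularities.ResolutionOfSingularities.Theorems.ValuativePatchingRelBlowupResolution
import Summits.ResolutionOfSingularities.ResolutionOfSingularities.Theorems.ValuativePatchingRelResolvingSystem
import Summits.ResolutionOfSingularities.ResolutionOfSingularities.Theorems.ValuativePatchingRel
import Literature.AlgebraicGeometry.Resolution.Blowups

/-!
# drefute gen 4 (resumed 11:30Z) — state certificate of the gen-1 v2/v3 stub set of line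
# `sandwiched-gluing` (crux stmt-ResolutionOfSingularities-0642, `Valuative.PatchingRel`)

Signatures copied verbatim from the published skeleton `Cruxes/PatchingRel/Lines/sandwiched_gluing.lean`
(gen-1 v2 final + v3 cut, 10:51Z). Every stub but the two atoms is closed by `exact` with a LANDED
Theorems declaration; the atoms `stub_sandwichedLocusResolution` (SANDᴸ, v2) and
`stub_sandwichedBlowupResolution` (SANDᵇ, v3) are the only `sorry`s, and SANDᴸ follows from SANDᵇ by
the landed bridge.
-/

open CategoryTheory AlgebraicGeometry
open Literature.AlgebraicGeometry.Resolution Literature.AlgebraicGeometry.Morphisms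
open Summit.ResolutionOfSingularities.ResolutionOfSingularities

namespace DrefuteG4v3

-- v2 ------------------------------------------------------------------------------------------

theorem T_sandwichedWeak_of_sandwichedLocus :
    ∀ p : ℕ, SandwichedLocusResolution.{0} p → SandwichedSingularitiesResolution.{0} p :=
  stub_sandwichedWeak_of_sandwichedLocus

theorem T_sandwichedLocus_of_resolutionInChar :
    ∀ p : ℕ, ResolutionInChar.{0} p → SandwichedLocusResolution.{0} p :=
  Theorems.stub_sandwichedLocus_of_resolutionInChar

theorem T_localRegLeification_of_sandwichedWeak :
    ∀ p : ℕ, SandwichedSingularitiesResolution.{0} p → ProperModel.LocalRegLeification.{0} p :=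
  Theorems.stub_localRegLeification_of_sandwichedWeak

theorem T_regLeification_of_sandwichedLocus :
    ∀ p : ℕ, SandwichedLocusResolution.{0} p → ProperModel.RegLeification.{0} p :=
  Theorems.stub_regLeification_of_sandwichedLocus

theorem T_sandwichedLocus_of_nagata_of_sandwichedWeak :
    ∀ p : ℕ, NagataCompactification.{0} → SandwichedSingularitiesResolution.{0} p →
      SandwichedLocusResolution.{0} p :=
  Theorems.stub_sandwichedLocus_of_nagata_of_sandwichedWeak

theorem T_resolutionInChar_of_properPatching : ∀ p : ℕ, p.Prime → ProperModel.TwoModelPatching.{0} p → (∀ (k K : Type) [Field k] [CharP k p] [Field K] [Algebra k K], (⊤ : IntermediateField k K).FG → ∀ O : ValuationSubring K, (∀ c : k, algebraMap k K c ∈ O) → ∀ R : Subalgebra k K, R.FG → R.toSubring ≤ O.toSubring → ∃ (A : Subalgebra k K) (h : A.toSubring ≤ O.toSubring), R ≤ A ∧ A.FG ∧ IsFractionRing A K ∧ IsRegularLocalRing (Localization.AtPrime (Ideal.comap (Subring.inclusion h) (IsLocalRing.maximalIdeal O)))) → ResolutionInChar.{0} p :=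
  Theorems.stub_resolutionInChar_of_properPatching

-- v3 ------------------------------------------------------------------------------------------

theorem T_exists_isPullback_of_isBlowup : ∀ (M : Scheme.{0}) [IsIntegral M] [IsLocallyNoetherian M] (O : M.Opens) (N₀ : Scheme.{0}) (π : N₀ ⟶ (O : Scheme.{0})) (I : (O : Scheme.{0}).IdealSheafData), I ≠ ⊥ → IsBlowup π I → ∃ (Z : Scheme.{0}) (ρ : Z ⟶ M) (s : N₀ ⟶ Z), IsIntegral Z ∧ IsProper ρ ∧ IsBirational ρ ∧ IsOpenImmersion s ∧ IsPullback s π ρ O.ι ∧ IsBlowup ρ (I.map O.ι) :=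
  Theorems.stub_exists_isPullback_of_isBlowup

theorem T_sandwichedLocus_of_sandwichedBlowup :
    ∀ p : ℕ, SandwichedBlowupResolution.{0} p → SandwichedLocusResolution.{0} p :=
  Theorems.stub_sandwichedLocus_of_sandwichedBlowup

theorem T_sandwichedLocusDimGt_of_sandwichedBlowupDimGt :
    ∀ p d : ℕ, SandwichedBlowupResolutionDimGt.{0} p d → SandwichedLocusResolutionDimGt.{0} p d :=
  Theorems.stub_sandwichedLocusDimGt_of_sandwichedBlowupDimGt

theorem T_sandwichedBlowup_of_blowupResolutionInChar :
    ∀ p : ℕ, BlowupResolutionInChar.{0} p → SandwichedBlowupResolution.{0} p :=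
  stub_sandwichedBlowup_of_blowupResolutionInChar

theorem T_resolutionInChar_of_blowupResolutionInChar :
    ∀ p : ℕ, BlowupResolutionInChar.{0} p → ResolutionInChar.{0} p :=
  Theorems.stub_resolutionInChar_of_blowupResolutionInChar

/-- v3 OPEN ATOM SANDᵇ. -/
theorem A_sandwichedBlowupResolution : ∀ p : ℕ, p.Prime → SandwichedBlowupResolution.{0} p := by
  sorry

/-- v2 atom SANDᴸ — now a consequence of the v3 atom by the landed bridge (no sorry of its own). -/
theorem A_sandwichedLocusResolution : ∀ p : ℕ, p.Prime → SandwichedLocusResolution.{0} p :=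
  fun p hp => Theorems.stub_sandwichedLocus_of_sandwichedBlowup p (A_sandwichedBlowupResolution p hp)

/-- Capstone (v2, landed `Theorems.patchingRel_of_sandwichedLocus`) fed by the v3 atom. -/
theorem crux_of_stubs : Summit.ResolutionOfSingularities.ResolutionOfSingularities.Theses.Valuative.PatchingRel :=
  Theorems.patchingRel_of_sandwichedLocus A_sandwichedLocusResolution

/-- The sharpening recommended by drefute g4 at 04:50Z is now a TREE THEOREM: the crux is
EQUIVALENT to `∀ p prime, LUrel_p → SANDᴸ_p` (`Theorems.patchingRel_iff_lurel_imp_sandwichedLocus`). -/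
example : Summit.ResolutionOfSingularities.ResolutionOfSingularities.Theses.Valuative.PatchingRel ↔
      ∀ p : ℕ, p.Prime →
        (∀ (k K : Type) [Field k] [CharP k p] [Field K] [Algebra k K],
          (⊤ : IntermediateField k K).FG → ∀ O : ValuationSubring K,
            (∀ c : k, algebraMap k K c ∈ O) → ∀ R : Subalgebra k K, R.FG →
              R.toSubring ≤ O.toSubring →
                ∃ (A : Subalgebra k K) (h : A.toSubring ≤ O.toSubring), R ≤ A ∧ A.FG ∧
                  IsFractionRing A K ∧ IsRegularLocalRing (Localization.AtPrime
                    (Ideal.comap (Subring.inclusion h) (IsLocalRing.maximalIdeal O)))) →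
          SandwichedLocusResolution.{0} p :=
  Theorems.patchingRel_iff_lurel_imp_sandwichedLocus

/-- For the v3 atom the same sharpening costs nothing either: `∀ p prime, LUrel_p → SANDᵇ_p`
already gives the crux (the converse is NOT formal: weak resolutions need not be blowings up). -/
theorem crux_of_sandwichedBlowup_sharp
    (hS : ∀ p : ℕ, p.Prime →
      (∀ (k K : Type) [Field k] [CharP k p] [Field K] [Algebra k K],
          (⊤ : IntermediateField k K).FG → ∀ O : ValuationSubring K,
            (∀ c : k, algebraMap k K c ∈ O) → ∀ R : Subalgebra k K, R.FG →
              R.toSubring ≤ O.toSubring →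
                ∃ (A : Subalgebra k K) (h : A.toSubring ≤ O.toSubring), R ≤ A ∧ A.FG ∧
                  IsFractionRing A K ∧ IsRegularLocalRing (Localization.AtPrime
                    (Ideal.comap (Subring.inclusion h) (IsLocalRing.maximalIdeal O)))) →
      SandwichedBlowupResolution.{0} p) :
    Summit.ResolutionOfSingularities.ResolutionOfSingularities.Theses.Valuative.PatchingRel :=
  Theorems.patchingRel_iff_lurel_imp_sandwichedLocus.mpr fun p hp hLU =>
    Theorems.stub_sandwichedLocus_of_sandwichedBlowup p (hS p hp hLU)

/-- Sanity (no junk, no vacuity at the degenerate end): a REGULAR `X` satisfies the conclusion of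
SANDᵇ with the unit ideal, by the tree's `isBlowup_id_top`; `⊤ ≠ ⊥` in `IdealSheafData` of a
non-empty scheme. -/
theorem sandwichedBlowup_conclusion_of_isRegular (X : Scheme.{0}) [Nonempty X]
    (hX : Scheme.IsRegular X) :
    ∃ (I : X.IdealSheafData) (X' : Scheme.{0}) (π : X' ⟶ X),
      I ≠ ⊥ ∧ IsBlowup π I ∧ Scheme.IsRegular X' := by
  refine ⟨⊤, X, 𝟙 X, ?_, isBlowup_id_top X, hX⟩
  intro h
  have hs := congrArg Scheme.IdealSheafData.support h
  rw [Scheme.IdealSheafData.support_top, Scheme.IdealSheafData.support_bot] at hs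
  have : (Classical.arbitrary X) ∈ ((⊥ : TopologicalSpace.Closeds X) : Set X) := by
    rw [hs]; trivial
  exact this

end DrefuteG4v3
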